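import Literature.Probability.LatticeModels.CollarLegModel

/-!
# Stub `stub_referenceLimit` of line `rainbow-monomials-in-excursion-kernels` — Part 2:
# the level / wiredness / pending bookkeeping of the collar walk (`CollarLegModel.WalkState.step`)

Crux `BoundaryDefectGaussianR` (stmt-CriticalPhenomena-14132). Geometry-free facts about the
annotated boundary walk `LegInsertionData.walk` of `Literature.Probability.LatticeModels.CollarLegModel`:

* one step of the walk: with nothing pending a silent dart changes nothing; a silent dart lowers the
  number of pending legs by at least one; an insertion `(L, σ)` leaves at most `L - 1` legs pending;
  the POTENTIAL `level + sgn · pending` is unchanged by silent darts and jumps by `σ L` at an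
  insertion met with nothing pending; the PARITY invariant "wired ⇔ level odd" (and "sgn odd while
  legs are pending") is preserved;
* along a list of darts: if every insertion `(L, σ)` starting at position `s < t` has `s + L ≤ T`,
  then at most `T - t` legs are pending after `t` darts (`pending_foldl_le`); parity is preserved and
  the potential after `t` darts is the initial one plus the sum of the contributions `σ L` of the
  insertions met, provided each was met with nothing pending (`invariant_foldl`);
* indexing of `walk` (`length_walk`, `getElem?_walk`): entry `t` is the `t`-th dart of the cycle with
  the states after `t` and `t + 1` darts.
-/

namespace Summit.CriticalPhenomena.CardyFormulaZ2.Cruxes.BoundaryDefectGaussianR.RainbowMonomialsInExcursionKernels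

open Literature.Probability.LatticeModels Literature.Probability.LatticeModels.CollarLegModel

/-! ### One step -/

/-- With nothing pending, a silent dart does not change the state. [folklore] -/
theorem step_none_of_pending (s : WalkState) (h : s.pending = 0) : s.step none = s := by
  simp [WalkState.step, h]

/-- A silent dart realises at least one pending leg (if any). [folklore] -/
theorem pending_step_none_le (s : WalkState) : (s.step none).pending ≤ s.pending - 1 := by
  simp only [WalkState.step]
  split_ifs with h1 h2 h3
  · omega
  · dsimp only; omega
  · dsimp only; omega
  · dsimp only; omega

/-- An insertion of `L` legs leaves at most `L - 1` of them pending. [folklore] -/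
theorem pending_step_some_le (s : WalkState) (L : ℕ) (σ : ℤ) : (s.step (some (L, σ))).pending ≤ L - 1 := by
  simp only [WalkState.step]
  split_ifs with h1 h2 h3
  · dsimp only; omega
  · dsimp only; omega
  · dsimp only; omega
  · dsimp only; omega

/-- The potential `level + sgn · pending` is unchanged by a silent dart. [folklore] -/
theorem potential_step_none (s : WalkState) :
    (s.step none).level + (s.step none).sgn * (s.step none).pending = s.level + s.sgn * s.pending := by
  simp only [WalkState.step]
  split_ifs with h1 h2 h3
  · rfl
  · dsimp only; rw [Nat.cast_sub (by omega)]; push_cast; ring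
  · dsimp only; rw [Nat.cast_sub h3]; push_cast; ring
  · dsimp only
    have : s.pending = 1 := by omega
    simp [this]

/-- At an insertion `(L, σ)` the potential becomes `level + σ L` (the old pending legs are
overwritten; in an admissible walk there are none). [folklore] -/
theorem potential_step_some (s : WalkState) (L : ℕ) (σ : ℤ) :
    (s.step (some (L, σ))).level + (s.step (some (L, σ))).sgn * (s.step (some (L, σ))).pending =
      s.level + σ * L := by
  simp only [WalkState.step]
  split_ifs with h1 h2 h3
  · dsimp only
  · dsimp only; rw [Nat.cast_sub (by omega)]; push_cast; ring
  · dsimp only; rw [Nat.cast_sub h3]; push_cast; ring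
  · dsimp only
    have : L = 1 := by omega
    subst this; simp

/-- The contribution of a dart to the potential: `σ L` for an insertion `(L, σ)` met with nothing
pending, `0` for a silent dart. [folklore] -/
theorem potential_step (s : WalkState) (o : Option (ℕ × ℤ)) (h : o ≠ none → s.pending = 0) :
    (s.step o).level + (s.step o).sgn * (s.step o).pending =
      s.level + s.sgn * s.pending + o.elim 0 (fun q => q.2 * (q.1 : ℤ)) := by
  rcases o with _ | ⟨L, σ⟩
  · rw [potential_step_none]; simp
  · rw [potential_step_some, h (by simp)]; simp

/-- The parity invariant of the walk is preserved by every dart: the stretch is wired iff its level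
is odd, and the sign of a pending insertion is odd (`±1`), provided insertion signs are odd. [folklore] -/
theorem parity_step (s : WalkState) (o : Option (ℕ × ℤ))
    (hw : s.wired = true ↔ s.level % 2 = 1) (hsgn : s.pending = 0 ∨ s.sgn % 2 = 1)
    (ho : ∀ L σ, o = some (L, σ) → σ % 2 = 1) :
    ((s.step o).wired = true ↔ (s.step o).level % 2 = 1) ∧ ((s.step o).pending = 0 ∨ (s.step o).sgn % 2 = 1) := by
  rcases o with _ | ⟨L, σ⟩
  · simp only [WalkState.step]
    split_ifs with h1 h2 h3
    · exact ⟨hw, hsgn⟩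
    · dsimp only
      rw [h2] at hw
      refine ⟨⟨fun h => ?_, fun h => ?_⟩, ?_⟩
      · exact absurd h (by simp)
      · exfalso; have := hw.1 rfl; omega
      · omega
    · dsimp only
      simp only [Bool.not_eq_true] at h2
      rw [h2] at hw ⊢
      refine ⟨⟨fun h => ?_, fun h => ?_⟩, ?_⟩
      · exact absurd h (by simp)
      · exfalso; have : ¬ s.level % 2 = 1 := fun h' => by simpa using hw.2 h'
        omega
      · omega
    · dsimp only
      simp only [Bool.not_eq_true] at h2
      rw [h2] at hw
      have : ¬ s.level % 2 = 1 := fun h' => by simpa using hw.2 h'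
      refine ⟨⟨fun _ => ?_, fun _ => rfl⟩, ?_⟩
      · omega
      · left; omega
  · have hσ := ho L σ rfl
    simp only [WalkState.step]
    split_ifs with h1 h2 h3
    · exact ⟨hw, Or.inl h1⟩
    · dsimp only
      rw [h2] at hw
      refine ⟨⟨fun h => ?_, fun h => ?_⟩, ?_⟩
      · exact absurd h (by simp)
      · exfalso; have := hw.1 rfl; omega
      · right; exact hσ
    · dsimp only
      simp only [Bool.not_eq_true] at h2
      rw [h2] at hw ⊢
      refine ⟨⟨fun h => ?_, fun h => ?_⟩, ?_⟩
      · exact absurd h (by simp)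
      · exfalso; have : ¬ s.level % 2 = 1 := fun h' => by simpa using hw.2 h'
        omega
      · right; exact hσ
    · dsimp only
      simp only [Bool.not_eq_true] at h2
      rw [h2] at hw
      have : ¬ s.level % 2 = 1 := fun h' => by simpa using hw.2 h'
      refine ⟨⟨fun _ => ?_, fun _ => rfl⟩, ?_⟩
      · omega
      · left; omega

/-! ### Along a list of darts -/

section Fold

variable (start : Dart → Option (ℕ × ℤ))

/-- The state after `t + 1` darts is the step of the state after `t` darts at dart `t`. [folklore] -/
theorem foldl_take_succ (s₀ : WalkState) (ds : List Dart) {t : ℕ} (ht : t < ds.length) :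
    List.foldl (fun s d => s.step (start d)) s₀ (ds.take (t + 1)) =
      (List.foldl (fun s d => s.step (start d)) s₀ (ds.take t)).step (start (ds[t])) := by
  rw [List.take_succ_eq_append_getElem ht, List.foldl_append, List.foldl_cons, List.foldl_nil]

/-- **Footprints.** If every insertion `(L, σ)` starting at a position `s < t` satisfies
`s + L ≤ T`, then after `t ≤ T` darts at most `T - t` legs are pending (in particular none at `t = T`). [folklore] -/
theorem pending_foldl_le (s₀ : WalkState) (hs₀ : s₀.pending = 0) (ds : List Dart) (T : ℕ) :
    ∀ t : ℕ, (ht : t ≤ ds.length) →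
      (∀ (s : ℕ) (hs : s < t) (L : ℕ) (σ : ℤ), start (ds[s]'(by omega)) = some (L, σ) → s + L ≤ T) →
      (List.foldl (fun s d => s.step (start d)) s₀ (ds.take t)).pending ≤ T - t := by
  intro t
  induction t with
  | zero => intro _ _; simp [hs₀]
  | succ t ih =>
    intro ht hst
    rw [foldl_take_succ start s₀ ds (by omega)]
    have ih' := ih (by omega) fun s hs L σ h => hst s (by omega) L σ h
    rcases hd : start ds[t] with _ | ⟨L, σ⟩
    · exact (pending_step_none_le _).trans (by omega)
    · have := hst t (by omega) L σ hd
      exact (pending_step_some_le _ L σ).trans (by omega)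

/-- **Potential and parity along the walk.** If every insertion before `t` is met with nothing
pending and all signs are odd, then the parity invariant holds after `t` darts and the potential
after `t` darts is the initial one plus the sum of the contributions `σ L` of the insertions met. [folklore] -/
theorem invariant_foldl (s₀ : WalkState) (hw₀ : s₀.wired = true ↔ s₀.level % 2 = 1)
    (hsgn₀ : s₀.pending = 0 ∨ s₀.sgn % 2 = 1) (hodd : ∀ d L σ, start d = some (L, σ) → σ % 2 = 1)
    (ds : List Dart) :
    ∀ t : ℕ, (ht : t ≤ ds.length) →
      (∀ (s : ℕ) (hs : s < t), start (ds[s]'(by omega)) ≠ none →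
        (List.foldl (fun s d => s.step (start d)) s₀ (ds.take s)).pending = 0) →
      ((List.foldl (fun s d => s.step (start d)) s₀ (ds.take t)).wired = true ↔
          (List.foldl (fun s d => s.step (start d)) s₀ (ds.take t)).level % 2 = 1) ∧
        ((List.foldl (fun s d => s.step (start d)) s₀ (ds.take t)).pending = 0 ∨
          (List.foldl (fun s d => s.step (start d)) s₀ (ds.take t)).sgn % 2 = 1) ∧
        (List.foldl (fun s d => s.step (start d)) s₀ (ds.take t)).level +
            (List.foldl (fun s d => s.step (start d)) s₀ (ds.take t)).sgn *
              (List.foldl (fun s d => s.step (start d)) s₀ (ds.take t)).pending =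
          s₀.level + s₀.sgn * s₀.pending +
            (((ds.take t).map fun d => (start d).elim 0 fun q => q.2 * (q.1 : ℤ))).sum := by
  intro t
  induction t with
  | zero => intro _ _; simpa using ⟨hw₀, hsgn₀⟩
  | succ t ih =>
    intro ht hst
    obtain ⟨ihw, ihs, ihp⟩ := ih (by omega) fun s hs h => hst s (by omega) h
    rw [foldl_take_succ start s₀ ds (by omega)]
    obtain ⟨hw', hs'⟩ := parity_step _ (start ds[t]) ihw ihs fun L σ h => hodd _ L σ h
    refine ⟨hw', hs', ?_⟩
    rw [potential_step _ _ fun h => hst t (by omega) h, ihp, List.take_succ_eq_append_getElem (by omega),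
      List.map_append, List.sum_append]
    simp only [List.map_cons, List.map_nil, List.sum_cons, List.sum_nil, add_zero]
    ring

end Fold

/-! ### Indexing the annotated walk -/

section Walk

variable (ι : LegInsertionData) (V : Finset (ℤ × ℤ)) {d₀ : Dart}

/-- The annotated walk, unfolded at the sink's exterior dart. [folklore] -/
theorem walk_eq (h : outDart V ι.sink = some d₀) :
    ι.walk V = (cycle V d₀).zip
      ((((cycle V d₀).scanl (fun s d => s.step (ι.startAt V d)) ι.init)).zip
        ((cycle V d₀).scanl (fun s d => s.step (ι.startAt V d)) ι.init).tail) := by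
  simp only [LegInsertionData.walk, h]

/-- The annotated walk has one entry per dart of the boundary cycle. [folklore] -/
theorem length_walk (h : outDart V ι.sink = some d₀) : (ι.walk V).length = (cycle V d₀).length := by
  rw [walk_eq ι V h]; simp

/-- Entry `t` of the annotated walk: the `t`-th dart of the cycle with the states after `t` and
after `t + 1` darts. [folklore] -/
theorem getElem?_walk (h : outDart V ι.sink = some d₀) {t : ℕ} (ht : t < (cycle V d₀).length) :
    (ι.walk V)[t]? = some ((cycle V d₀)[t],
      List.foldl (fun s d => s.step (ι.startAt V d)) ι.init ((cycle V d₀).take t),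
      List.foldl (fun s d => s.step (ι.startAt V d)) ι.init ((cycle V d₀).take (t + 1))) := by
  rw [walk_eq ι V h, List.getElem?_zip_eq_some]
  refine ⟨List.getElem?_eq_getElem ht, ?_⟩
  rw [List.getElem?_zip_eq_some]
  refine ⟨?_, ?_⟩
  · rw [List.getElem?_scanl, if_pos ht.le]
  · rw [List.getElem?_tail, List.getElem?_scanl, if_pos (by omega)]

/-- Membership in the annotated walk, by index. [folklore] -/
theorem mem_walk_iff (h : outDart V ι.sink = some d₀) {e : Dart × WalkState × WalkState} :
    e ∈ ι.walk V ↔ ∃ (t : ℕ) (ht : t < (cycle V d₀).length), e = ((cycle V d₀)[t],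
      List.foldl (fun s d => s.step (ι.startAt V d)) ι.init ((cycle V d₀).take t),
      List.foldl (fun s d => s.step (ι.startAt V d)) ι.init ((cycle V d₀).take (t + 1))) := by
  rw [List.mem_iff_getElem?]
  constructor
  · rintro ⟨t, hte⟩
    have ht : t < (cycle V d₀).length := by
      have := (List.getElem?_eq_some_iff.1 hte).1
      rwa [length_walk ι V h] at this
    rw [getElem?_walk ι V h ht] at hte
    exact ⟨t, ht, (Option.some.inj hte).symm⟩
  · rintro ⟨t, ht, rfl⟩
    exact ⟨t, getElem?_walk ι V h ht⟩

/-- The last entry of the annotated walk carries the final state (after all darts). [folklore] -/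
theorem getLast?_walk (h : outDart V ι.sink = some d₀) (hP : 0 < (cycle V d₀).length) :
    (ι.walk V).getLast? = some ((cycle V d₀)[(cycle V d₀).length - 1],
      List.foldl (fun s d => s.step (ι.startAt V d)) ι.init ((cycle V d₀).take ((cycle V d₀).length - 1)),
      List.foldl (fun s d => s.step (ι.startAt V d)) ι.init (cycle V d₀)) := by
  rw [List.getLast?_eq_getElem?, length_walk ι V h, getElem?_walk ι V h (by omega),
    Nat.sub_add_cancel hP, List.take_length]

end Walk

/-- **Sub-goal `s4_walkStep` of stub 4** (registered on stmt-CriticalPhenomena-14132): the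
bookkeeping of ONE dart of the collar walk — a silent dart realises at least one pending leg, an
insertion of `L` legs leaves at most `L - 1` pending, the potential `level + sgn · pending` changes
by the contribution `σ L` of an insertion met with nothing pending (`0` for a silent dart), and the
parity invariant "wired ⇔ level odd, pending signs odd" is preserved. [folklore] -/
theorem s4_walkStep : ∀ (s : Literature.Probability.LatticeModels.CollarLegModel.WalkState) (o : Option (ℕ × ℤ)), (s.step none).pending ≤ s.pending - 1 ∧ (∀ (L : ℕ) (σ : ℤ), (s.step (some (L, σ))).pending ≤ L - 1) ∧ ((o ≠ none → s.pending = 0) → (s.step o).level + (s.step o).sgn * (s.step o).pending = s.level + s.sgn * s.pending + o.elim 0 (fun q ↦ q.2 * (q.1 : ℤ))) ∧ ((s.wired = true ↔ s.level % 2 = 1) → (s.pending = 0 ∨ s.sgn % 2 = 1) → (∀ (L : ℕ) (σ : ℤ), o = some (L, σ) → σ % 2 = 1) → ((s.step o).wired = true ↔ (s.step o).level % 2 = 1) ∧ ((s.step o).pending = 0 ∨ (s.step o).sgn % 2 = 1)) :=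
  fun s o => ⟨pending_step_none_le s, pending_step_some_le s, potential_step s o, parity_step s o⟩

end Summit.CriticalPhenomena.CardyFormulaZ2.Cruxes.BoundaryDefectGaussianR.RainbowMonomialsInExcursionKernels
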